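import Summits.ValiantsHypothesis.ValiantsHypothesis.Theses.SOSTau
import Literature.Computability.AlgebraicComplexity.TavenasVnWitness
import Literature.Computability.AlgebraicComplexity.ValiantCriterion
import Literature.Computability.AlgebraicComplexity.ValiantClasses
import Summits.ValiantsHypothesis.ValiantsHypothesis.Theorems.FeketeSOSSOSMagnificationStubVnpAssembly
import Summits.ValiantsHypothesis.ValiantsHypothesis.Theorems.FeketeSOSSOSMagnificationStubDigitKronecker
import Literature.Computability.AlgebraicComplexity.SetMultilinear

/-!
# SketchWitness — the TRANSCRIPT FORM of crux idea `definability-projection`, identity half PROVED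

The Boolean-sum witness for the hex digit lift of `V_{4m}` built from Tavenas' LANDED circuit `vCirc (4m)`:
`W_m = VALID(vCirc (4m))(e,y) · HSEL(X; e) · Π_l (1 + (2^{2^l} − 1)·w_l(e,y))`, and the identity
`bsum W_m = Σ_{i<16^m} 2^{vExp (4m) i} Π_j X_{(j, i_j)}` (zero new circuits).
-/

set_option linter.dupNamespace false

noncomputable section

open MvPolynomial Finset
open Literature.Computability.AlgebraicComplexity
open Literature.Computability.Complexity (CktSize B2 Circuit)
open CircuitArith BoolGadgets DefVNP TavenasVn
open Summit.ValiantsHypothesis.ValiantsHypothesis.Theorems.FeketeSOSSOSMagnification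
  (isVNPFamily_of_levelwise' dk_isSetMultilinear_lift dk_totalDegree_lift dk_aeval_lift dk_sum_digit_mul_pow)

namespace Summit.ValiantsHypothesis.ValiantsHypothesis.Cruxes.HutchinsonMagnification.DefinabilityProjection

/-- Genuine variables: one-hot hex digit variables. -/
abbrev V (m : ℕ) : Type := Fin m × Fin 16

/-- Boolean block: the `4m` exponent bits ⊕ the transcript of Tavenas' circuit `vCirc (4m)`. -/
abbrev B (m : ℕ) : Type := TavenasVn.BB (4 * m)

/-- The hex digit `j` of a bit vector. -/
def hexDigit (m : ℕ) (e : Fin (4 * m) → Bool) (j : Fin m) : Fin 16 :=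
  ⟨Nat.ofBits (fun r : Fin 4 => e ⟨4 * (j : ℕ) + (r : ℕ), by omega⟩),
    (Nat.ofBits_lt_two_pow _).trans_eq (by norm_num)⟩

/-- Digit/bit dictionary: `ofBits e / 16^j % 16 = hexDigit e j`. -/
theorem ofBits_div_pow_mod (m : ℕ) (e : Fin (4 * m) → Bool) (j : Fin m) :
    Nat.ofBits e / 16 ^ (j : ℕ) % 16 = (hexDigit m e j : ℕ) := by
  apply Nat.eq_of_testBit_eq
  intro i
  have h16 : (16 : ℕ) ^ (j : ℕ) = 2 ^ (4 * (j : ℕ)) := by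
    rw [pow_mul]; norm_num
  have hmod : Nat.ofBits e / 2 ^ (4 * (j : ℕ)) % 16 = Nat.ofBits e / 2 ^ (4 * (j : ℕ)) % 2 ^ 4 := by
    norm_num
  rw [h16, hmod, Nat.testBit_mod_two_pow, Nat.testBit_div_two_pow]
  unfold hexDigit
  by_cases hi : i < 4
  · rw [decide_eq_true hi, Bool.true_and, Nat.testBit_ofBits_lt _ _ hi]
    have hlt : i + 4 * (j : ℕ) < 4 * m := by omega
    rw [Nat.testBit_ofBits_lt _ _ hlt]
    congr 1
    exact Fin.ext (by simp; omega)
  · rw [decide_eq_false hi, Bool.false_and, Nat.testBit_ofBits_ge _ _ (by omega)]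

/-- The bits of `hexDigit e j` are the block bits. -/
theorem testBit_hexDigit (m : ℕ) (e : Fin (4 * m) → Bool) (j : Fin m) (r : Fin 4) :
    Nat.testBit (hexDigit m e j : ℕ) (r : ℕ) = e ⟨4 * (j : ℕ) + (r : ℕ), by omega⟩ := by
  unfold hexDigit
  simp only
  rw [Nat.testBit_ofBits_lt _ _ r.isLt]

/-- A hex digit is determined by its four bits. -/
theorem eq_hexDigit_iff (m : ℕ) (e : Fin (4 * m) → Bool) (j : Fin m) (h : Fin 16) :
    (∀ r : Fin 4, Nat.testBit (h : ℕ) (r : ℕ) = e ⟨4 * (j : ℕ) + (r : ℕ), by omega⟩) ↔ h = hexDigit m e j := by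
  constructor
  · intro H
    apply Fin.ext
    apply Nat.eq_of_testBit_eq
    intro i
    by_cases hi : i < 4
    · rw [H ⟨i, hi⟩, testBit_hexDigit m e j ⟨i, hi⟩]
    · have h1 : (h : ℕ) < 2 ^ i := lt_of_lt_of_le h.isLt (by
        calc (16 : ℕ) = 2 ^ 4 := by norm_num
          _ ≤ 2 ^ i := Nat.pow_le_pow_right (by norm_num) (by omega))
      have h2 : (hexDigit m e j : ℕ) < 2 ^ i := lt_of_lt_of_le (hexDigit m e j).isLt (by
        calc (16 : ℕ) = 2 ^ 4 := by norm_num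
          _ ≤ 2 ^ i := Nat.pow_le_pow_right (by norm_num) (by omega))
      rw [Nat.testBit_lt_two_pow h1, Nat.testBit_lt_two_pow h2]
  · rintro rfl r
    exact testBit_hexDigit m e j r

/-! ### The witness -/

/-- Hex selector factor of block `j`: `Σ_h X_{(j,h)} · Π_{r<4} lit (bit_r h) (e_{4j+r})`. -/
def hselFactor (m : ℕ) (j : Fin m) : MvPolynomial (V m ⊕ B m) ℂ :=
  ∑ h : Fin 16, X (Sum.inl (j, h)) *
    ∏ r : Fin 4, lit (Nat.testBit (h : ℕ) (r : ℕ))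
      (X (Sum.inr (Sum.inl (⟨4 * (j : ℕ) + (r : ℕ), by omega⟩ : Fin (4 * m)))))

/-- The hex selector `HSEL = Π_j hselFactor j`. -/
def hsel (m : ℕ) : MvPolynomial (V m ⊕ B m) ℂ := ∏ j : Fin m, hselFactor m j

/-- The factor of output bit `l`: `1 + (2^{2^l} − 1)·w_l`. -/
def zFactor (m : ℕ) (l : Fin (TavenasVn.R (4 * m))) : MvPolynomial (V m ⊕ B m) ℂ :=
  1 + (C ((2 : ℂ) ^ 2 ^ (l : ℕ)) - 1) *
    rename Sum.inr (wirePoly (k := ℂ) (vCirc (4 * m)).size (vOut (4 * m) l))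

/-- The coefficient-magnitude selector `Π_l zFactor l` (z-block already projected to `2^{2^l}`). -/
def zprod (m : ℕ) : MvPolynomial (V m ⊕ B m) ℂ := ∏ l : Fin (TavenasVn.R (4 * m)), zFactor m l

/-- **The transcript witness** `W_m = VALID(vCirc (4m)) · HSEL · ZPROD`. -/
def witness (m : ℕ) : MvPolynomial (V m ⊕ B m) ℂ :=
  rename Sum.inr (validPoly (k := ℂ) (vCirc (4 * m))) * hsel m * zprod m

/-! ### Evaluation at Boolean points of the block -/

theorem toK_comp_sumElim (m : ℕ) (b : Fin (4 * m) → Bool) (y : Fin (vCirc (4 * m)).size → Bool) :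
    (toK ℂ ∘ Sum.elim b y) = bpt ℂ b y := by
  funext v; cases v <;> rfl

theorem aeval_φb_X_inl {m : ℕ} (e : B m → Bool) (v : V m) :
    aeval (φb (k := ℂ) (σ := V m) e) (X (Sum.inl v) : MvPolynomial (V m ⊕ B m) ℂ) = X v := by
  simp [φb]

theorem aeval_φb_X_inr {m : ℕ} (e : B m → Bool) (w : B m) :
    aeval (φb (k := ℂ) (σ := V m) e) (X (Sum.inr w) : MvPolynomial (V m ⊕ B m) ℂ) = C (toK ℂ (e w)) := by
  simp [φb]

/-- A literal at a Boolean point is an equality indicator. -/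
theorem aeval_φb_lit {m : ℕ} (e : B m → Bool) (a : Bool) (w : B m) :
    aeval (φb (k := ℂ) (σ := V m) e) (lit a (X (Sum.inr w) : MvPolynomial (V m ⊕ B m) ℂ)) =
      if a = e w then 1 else 0 := by
  cases a <;> cases hw : e w <;> simp [CircuitArith.lit, φb, toK, hw, map_sub]

/-- The hex selector factor at a Boolean point picks the variable of the encoded digit. -/
theorem aeval_φb_hselFactor (m : ℕ) (e : B m → Bool) (j : Fin m) :
    aeval (φb (k := ℂ) (σ := V m) e) (hselFactor m j) = X (j, hexDigit m (fun t => e (Sum.inl t)) j) := by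
  classical
  unfold hselFactor
  rw [map_sum]
  have hterm : ∀ h : Fin 16, aeval (φb (k := ℂ) (σ := V m) e) ((X (Sum.inl (j, h)) : MvPolynomial (V m ⊕ B m) ℂ) *
      ∏ r : Fin 4, lit (Nat.testBit (h : ℕ) (r : ℕ))
        (X (Sum.inr (Sum.inl (⟨4 * (j : ℕ) + (r : ℕ), by omega⟩ : Fin (4 * m)))))) =
      if h = hexDigit m (fun t => e (Sum.inl t)) j then X (j, h) else 0 := by
    intro h
    rw [map_mul, map_prod, aeval_φb_X_inl]
    simp only [aeval_φb_lit]
    rw [Fintype.prod_boole]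
    by_cases hh : h = hexDigit m (fun t => e (Sum.inl t)) j
    · rw [if_pos hh, if_pos ((eq_hexDigit_iff m (fun t => e (Sum.inl t)) j h).2 hh), mul_one]
    · rw [if_neg hh, if_neg (fun H => hh ((eq_hexDigit_iff m (fun t => e (Sum.inl t)) j h).1 H)), mul_zero]
  simp only [hterm]
  rw [Finset.sum_ite_eq' Finset.univ (hexDigit m (fun t => e (Sum.inl t)) j) (fun h => (X (j, h) : MvPolynomial (V m) ℂ))]
  simp

/-- The hex selector at a Boolean point is the one-hot monomial of the encoded digits. -/
theorem aeval_φb_hsel (m : ℕ) (e : B m → Bool) :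
    aeval (φb (k := ℂ) (σ := V m) e) (hsel m) = ∏ j : Fin m, X (j, hexDigit m (fun t => e (Sum.inl t)) j) := by
  unfold hsel
  rw [map_prod]
  exact Finset.prod_congr rfl fun j _ => aeval_φb_hselFactor m e j

/-- The output-bit factor at a Boolean point `(b, y)`: `2^{2^l}` if the wire is on, else `1`. -/
theorem aeval_φb_zFactor (m : ℕ) (b : Fin (4 * m) → Bool) (y : Fin (vCirc (4 * m)).size → Bool)
    (l : Fin (TavenasVn.R (4 * m))) :
    aeval (φb (k := ℂ) (σ := V m) (Sum.elim b y)) (zFactor m l) =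
      if bwval b y (vOut (4 * m) l) then C ((2 : ℂ) ^ 2 ^ (l : ℕ)) else 1 := by
  unfold zFactor
  rw [map_add, map_one, map_mul, map_sub, map_one, MvPolynomial.aeval_C, MvPolynomial.algebraMap_eq,
    aeval_φb_rename_inr, toK_comp_sumElim, eval_wirePoly]
  cases bwval b y (vOut (4 * m) l) <;> simp [toK]

/-- The magnitude selector at a Boolean point. -/
theorem aeval_φb_zprod (m : ℕ) (b : Fin (4 * m) → Bool) (y : Fin (vCirc (4 * m)).size → Bool) :
    aeval (φb (k := ℂ) (σ := V m) (Sum.elim b y)) (zprod m) =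
      ∏ l : Fin (TavenasVn.R (4 * m)), (if bwval b y (vOut (4 * m) l) then C ((2 : ℂ) ^ 2 ^ (l : ℕ)) else 1) := by
  unfold zprod
  rw [map_prod]
  exact Finset.prod_congr rfl fun l _ => aeval_φb_zFactor m b y l

/-- A product of bit-selected powers `2^{2^l}` is `2^{ofBits}`. -/
theorem prod_ite_pow (m : ℕ) {R : ℕ} (c : Fin R → Bool) :
    (∏ l : Fin R, (if c l then C ((2 : ℂ) ^ 2 ^ (l : ℕ)) else 1 : MvPolynomial (V m) ℂ)) =
      C ((2 : ℂ) ^ Nat.ofBits c) := by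
  have h : ∀ l : Fin R, (if c l then C ((2 : ℂ) ^ 2 ^ (l : ℕ)) else 1 : MvPolynomial (V m) ℂ) =
      C ((2 : ℂ) ^ ((c l).toNat * 2 ^ (l : ℕ))) := by
    intro l; cases c l <;> simp
  simp only [h]
  rw [← map_prod, Finset.prod_pow_eq_pow_sum, ← ofBits_eq_sum]

/-- **The witness at a Boolean point** `(b, y)`: `VALID(b,y) · Π_j X_{(j, digit_j b)} · Π_l (wire_l ? 2^{2^l} : 1)`. -/
theorem aeval_φb_witness (m : ℕ) (b : Fin (4 * m) → Bool) (y : Fin (vCirc (4 * m)).size → Bool) :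
    aeval (φb (k := ℂ) (σ := V m) (Sum.elim b y)) (witness m) =
      C (MvPolynomial.eval (bpt ℂ b y) (validPoly (vCirc (4 * m)))) *
        ((∏ j : Fin m, X (j, hexDigit m b j)) *
          ∏ l : Fin (TavenasVn.R (4 * m)), (if bwval b y (vOut (4 * m) l) then C ((2 : ℂ) ^ 2 ^ (l : ℕ)) else 1)) := by
  unfold witness
  rw [map_mul, map_mul, aeval_φb_rename_inr, toK_comp_sumElim, aeval_φb_hsel, aeval_φb_zprod, mul_assoc]
  rfl

/-- **The Boolean sum of the transcript witness, in bits** (transcript collapse). -/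
theorem bsum_witness_bits (m : ℕ) :
    bsum (witness m) = ∑ b : Fin (4 * m) → Bool,
      C ((2 : ℂ) ^ vExp (4 * m) (Nat.ofBits b)) * ∏ j : Fin m, (X (j, hexDigit m b j) : MvPolynomial (V m) ℂ) := by
  unfold bsum
  rw [sum_BB]
  refine Finset.sum_congr rfl fun b _ => ?_
  simp only [aeval_φb_witness]
  rw [sum_C_eval_validPoly_mul (vCirc (4 * m)) (isOver_vCirc (4 * m)) b]
  simp only [bwval_trueTranscript_vOut]
  rw [prod_ite_pow, mul_comm]
  congr 2
  rw [vExpBits, Literature.Computability.Complexity.ArithCkt.ofBits_bitsOf,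
    Nat.mod_eq_of_lt (vExp_lt_two_pow_R (4 * m) b)]

/-- `16^m = 2^{4m}` reindexing: the bit-indexed sum is the hex lift. -/
theorem sum_bits_eq_hexLift (m : ℕ) :
    (∑ e : Fin (4 * m) → Bool, C ((2 : ℂ) ^ vExp (4 * m) (Nat.ofBits e)) *
        ∏ j : Fin m, (X (j, hexDigit m e j) : MvPolynomial (Fin m × Fin 16) ℂ)) =
      ∑ i ∈ Finset.range (16 ^ m), C ((2 : ℂ) ^ vExp (4 * m) i) *
        ∏ j : Fin m, X (j, (⟨i / 16 ^ (j : ℕ) % 16, Nat.mod_lt _ (by norm_num)⟩ : Fin 16)) := by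
  have h16 : (16 : ℕ) ^ m = 2 ^ (4 * m) := by rw [pow_mul]; norm_num
  rw [h16, ← BoolGadgets.sum_boolVec_eq_sum_range (fun i => C ((2 : ℂ) ^ vExp (4 * m) i) *
    ∏ j : Fin m, (X (j, (⟨i / 16 ^ (j : ℕ) % 16, Nat.mod_lt _ (by norm_num)⟩ : Fin 16)) :
      MvPolynomial (Fin m × Fin 16) ℂ))]
  refine Finset.sum_congr rfl fun e _ => ?_
  congr 1
  refine Finset.prod_congr rfl fun j _ => ?_
  congr 2
  exact Fin.ext (ofBits_div_pow_mod m e j).symm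

/-- **THE IDENTITY (PROVED): the Boolean sum of the transcript witness is the hex digit lift of `V_{4m}`.** -/
theorem bsum_witness (m : ℕ) :
    bsum (witness m) = ∑ i ∈ Finset.range (16 ^ m), C ((2 : ℂ) ^ vExp (4 * m) i) *
      ∏ j : Fin m, X (j, (⟨i / 16 ^ (j : ℕ) % 16, Nat.mod_lt _ (by norm_num)⟩ : Fin 16)) := by
  rw [bsum_witness_bits, sum_bits_eq_hexLift]

/-- The same in Valiant's `boolSum` form (Boolean block enumerated by `Fin`), ready for Def. 2.5. -/
theorem boolSum_witness (m : ℕ) :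
    boolSum (rename (Sum.map id (Fintype.equivFin (B m))) (witness m)) =
      ∑ i ∈ Finset.range (16 ^ m), C ((2 : ℂ) ^ vExp (4 * m) i) *
        ∏ j : Fin m, X (j, (⟨i / 16 ^ (j : ℕ) % 16, Nat.mod_lt _ (by norm_num)⟩ : Fin 16)) := by
  classical
  rw [DefVNP.boolSum_rename_equiv, bsum_witness]

/-! ### Cost bounds: Boolean length, complexity, degree -/

theorem complexity_validPoly_le' {ι : Type*} (Q : Circuit ι) :
    complexity (validPoly (k := ℂ) Q) ≤ 60 * Q.size := by
  unfold validPoly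
  refine (complexity_finset_prod_le _ _).trans ?_
  calc ∑ j : Fin Q.size, complexity (consPoly (k := ℂ) Q j) + (Finset.univ : Finset (Fin Q.size)).card
      ≤ ∑ _j : Fin Q.size, 59 + (Finset.univ : Finset (Fin Q.size)).card :=
        Nat.add_le_add_right (Finset.sum_le_sum fun j _ => complexity_consPoly_le Q j) _
    _ = 60 * Q.size := by
        rw [Finset.sum_const, Finset.card_univ, Fintype.card_fin, smul_eq_mul]; ring

theorem totalDegree_validPoly_le' {ι : Type*} (Q : Circuit ι) :
    (validPoly (k := ℂ) Q).totalDegree ≤ 3 * Q.size := by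
  unfold validPoly
  refine (totalDegree_finsetProd _ _).trans ?_
  calc ∑ j : Fin Q.size, (consPoly (k := ℂ) Q j).totalDegree ≤ ∑ _j : Fin Q.size, 3 :=
        Finset.sum_le_sum fun j _ => totalDegree_consPoly_le Q j
    _ = 3 * Q.size := by rw [Finset.sum_const, Finset.card_univ, Fintype.card_fin, smul_eq_mul]; ring

theorem complexity_hselFactor_le (m : ℕ) (j : Fin m) : complexity (hselFactor m j) ≤ 224 := by
  unfold hselFactor
  refine (complexity_finset_sum_le _ _).trans ?_
  have hterm : ∀ h : Fin 16, complexity ((X (Sum.inl (j, h)) : MvPolynomial (V m ⊕ B m) ℂ) *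
      ∏ r : Fin 4, lit (Nat.testBit (h : ℕ) (r : ℕ))
        (X (Sum.inr (Sum.inl (⟨4 * (j : ℕ) + (r : ℕ), by omega⟩ : Fin (4 * m)))))) ≤ 13 := by
    intro h
    refine (complexity_mul_le_holds _ _).trans ?_
    rw [complexity_X_holds]
    have hl : ∀ r : Fin 4, complexity (lit (Nat.testBit (h : ℕ) (r : ℕ))
        (X (Sum.inr (Sum.inl (⟨4 * (j : ℕ) + (r : ℕ), by omega⟩ : Fin (4 * m)))) :
          MvPolynomial (V m ⊕ B m) ℂ)) ≤ 2 := fun r =>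
      (complexity_lit_le _ _).trans (by rw [complexity_X_holds])
    have hp := complexity_finset_prod_le (Finset.univ : Finset (Fin 4))
      (fun r => (lit (Nat.testBit (h : ℕ) (r : ℕ))
        (X (Sum.inr (Sum.inl (⟨4 * (j : ℕ) + (r : ℕ), by omega⟩ : Fin (4 * m)))) :
          MvPolynomial (V m ⊕ B m) ℂ)))
    have hs : ∑ r : Fin 4, complexity (lit (Nat.testBit (h : ℕ) (r : ℕ))
        (X (Sum.inr (Sum.inl (⟨4 * (j : ℕ) + (r : ℕ), by omega⟩ : Fin (4 * m)))) :
          MvPolynomial (V m ⊕ B m) ℂ)) ≤ ∑ _r : Fin 4, 2 := Finset.sum_le_sum fun r _ => hl r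
    rw [Finset.sum_const, Finset.card_univ, Fintype.card_fin, smul_eq_mul] at hs
    rw [Finset.card_univ, Fintype.card_fin] at hp
    omega
  calc ∑ h : Fin 16, complexity ((X (Sum.inl (j, h)) : MvPolynomial (V m ⊕ B m) ℂ) *
        ∏ r : Fin 4, lit (Nat.testBit (h : ℕ) (r : ℕ))
          (X (Sum.inr (Sum.inl (⟨4 * (j : ℕ) + (r : ℕ), by omega⟩ : Fin (4 * m)))))) +
        (Finset.univ : Finset (Fin 16)).card
      ≤ ∑ _h : Fin 16, 13 + (Finset.univ : Finset (Fin 16)).card :=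
        Nat.add_le_add_right (Finset.sum_le_sum fun h _ => hterm h) _
    _ = 224 := by rw [Finset.sum_const, Finset.card_univ, Fintype.card_fin, smul_eq_mul]

theorem complexity_hsel_le (m : ℕ) : complexity (hsel m) ≤ 225 * m := by
  unfold hsel
  refine (complexity_finset_prod_le _ _).trans ?_
  calc ∑ j : Fin m, complexity (hselFactor m j) + (Finset.univ : Finset (Fin m)).card
      ≤ ∑ _j : Fin m, 224 + (Finset.univ : Finset (Fin m)).card :=
        Nat.add_le_add_right (Finset.sum_le_sum fun j _ => complexity_hselFactor_le m j) _
    _ = 225 * m := by rw [Finset.sum_const, Finset.card_univ, Fintype.card_fin, smul_eq_mul]; ring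

theorem complexity_zFactor_le (m : ℕ) (l : Fin (TavenasVn.R (4 * m))) : complexity (zFactor m l) ≤ 2 := by
  unfold zFactor
  have hC : (C ((2 : ℂ) ^ 2 ^ (l : ℕ)) - 1 : MvPolynomial (V m ⊕ B m) ℂ) = C ((2 : ℂ) ^ 2 ^ (l : ℕ) - 1) := by
    rw [map_sub, C_1]
  have h1 : complexity ((C ((2 : ℂ) ^ 2 ^ (l : ℕ)) - 1) *
      rename Sum.inr (wirePoly (k := ℂ) (vCirc (4 * m)).size (vOut (4 * m) l)) :
        MvPolynomial (V m ⊕ B m) ℂ) ≤ 1 := by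
    refine (complexity_mul_le_holds _ _).trans ?_
    rw [hC, complexity_C_holds]
    have hw := (complexity_rename_le_holds' (Sum.inr : B m → V m ⊕ B m)
      (wirePoly (k := ℂ) (vCirc (4 * m)).size (vOut (4 * m) l)))
    rw [complexity_wirePoly] at hw
    omega
  have h2 := complexity_add_le_holds (1 : MvPolynomial (V m ⊕ B m) ℂ)
    ((C ((2 : ℂ) ^ 2 ^ (l : ℕ)) - 1) *
      rename Sum.inr (wirePoly (k := ℂ) (vCirc (4 * m)).size (vOut (4 * m) l)))
  have h3 : complexity (1 : MvPolynomial (V m ⊕ B m) ℂ) = 0 := by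
    rw [← C_1]; exact complexity_C_holds _
  omega

theorem complexity_zprod_le (m : ℕ) : complexity (zprod m) ≤ 3 * TavenasVn.R (4 * m) := by
  unfold zprod
  refine (complexity_finset_prod_le _ _).trans ?_
  calc ∑ l : Fin (TavenasVn.R (4 * m)), complexity (zFactor m l) +
        (Finset.univ : Finset (Fin (TavenasVn.R (4 * m)))).card
      ≤ ∑ _l : Fin (TavenasVn.R (4 * m)), 2 + (Finset.univ : Finset (Fin (TavenasVn.R (4 * m)))).card :=
        Nat.add_le_add_right (Finset.sum_le_sum fun l _ => complexity_zFactor_le m l) _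
    _ = 3 * TavenasVn.R (4 * m) := by
        rw [Finset.sum_const, Finset.card_univ, Fintype.card_fin, smul_eq_mul]; ring

/-- **Complexity of the witness**: `≤ 60·|vCirc (4m)| + 225 m + 3(8m+3) + 2`. -/
theorem complexity_witness_le (m : ℕ) :
    complexity (witness m) ≤ 60 * (vCirc (4 * m)).size + 225 * m + 3 * TavenasVn.R (4 * m) + 2 := by
  unfold witness
  have hv : complexity (rename Sum.inr (validPoly (k := ℂ) (vCirc (4 * m))) : MvPolynomial (V m ⊕ B m) ℂ) ≤
      60 * (vCirc (4 * m)).size :=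
    (complexity_rename_le_holds' _ _).trans (complexity_validPoly_le' _)
  have h1 := complexity_mul_le_holds (rename Sum.inr (validPoly (k := ℂ) (vCirc (4 * m))) : MvPolynomial (V m ⊕ B m) ℂ)
    (hsel m)
  have h2 := complexity_mul_le_holds ((rename Sum.inr (validPoly (k := ℂ) (vCirc (4 * m))) : MvPolynomial (V m ⊕ B m) ℂ) *
    hsel m) (zprod m)
  have h3 := complexity_hsel_le m
  have h4 := complexity_zprod_le m
  omega

theorem totalDegree_hselFactor_le (m : ℕ) (j : Fin m) : (hselFactor m j).totalDegree ≤ 5 := by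
  unfold hselFactor
  refine totalDegree_finsetSum_le fun h _ => ?_
  refine (totalDegree_mul _ _).trans ?_
  have hX := totalDegree_X_le_one' (k := ℂ) (Sum.inl (j, h) : V m ⊕ B m)
  have hp := totalDegree_finsetProd (Finset.univ : Finset (Fin 4))
    (fun r => (lit (Nat.testBit (h : ℕ) (r : ℕ))
      (X (Sum.inr (Sum.inl (⟨4 * (j : ℕ) + (r : ℕ), by omega⟩ : Fin (4 * m)))) :
        MvPolynomial (V m ⊕ B m) ℂ)))
  have hs : ∑ r : Fin 4, (lit (Nat.testBit (h : ℕ) (r : ℕ))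
      (X (Sum.inr (Sum.inl (⟨4 * (j : ℕ) + (r : ℕ), by omega⟩ : Fin (4 * m)))) :
        MvPolynomial (V m ⊕ B m) ℂ)).totalDegree ≤ ∑ _r : Fin 4, 1 :=
    Finset.sum_le_sum fun r _ => (totalDegree_lit_le _ _).trans (totalDegree_X_le_one' (k := ℂ) _)
  rw [Finset.sum_const, Finset.card_univ, Fintype.card_fin, smul_eq_mul] at hs
  omega

theorem totalDegree_hsel_le (m : ℕ) : (hsel m).totalDegree ≤ 5 * m := by
  unfold hsel
  refine (totalDegree_finsetProd _ _).trans ?_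
  calc ∑ j : Fin m, (hselFactor m j).totalDegree ≤ ∑ _j : Fin m, 5 :=
        Finset.sum_le_sum fun j _ => totalDegree_hselFactor_le m j
    _ = 5 * m := by rw [Finset.sum_const, Finset.card_univ, Fintype.card_fin, smul_eq_mul]; ring

theorem totalDegree_zFactor_le (m : ℕ) (l : Fin (TavenasVn.R (4 * m))) : (zFactor m l).totalDegree ≤ 1 := by
  unfold zFactor
  have hC : (C ((2 : ℂ) ^ 2 ^ (l : ℕ)) - 1 : MvPolynomial (V m ⊕ B m) ℂ) = C ((2 : ℂ) ^ 2 ^ (l : ℕ) - 1) := by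
    rw [map_sub, C_1]
  rw [hC]
  refine (totalDegree_add _ _).trans (max_le (by rw [totalDegree_one]; exact Nat.zero_le _) ?_)
  refine (totalDegree_mul _ _).trans ?_
  rw [totalDegree_C, zero_add]
  exact (totalDegree_rename_le _ _).trans (totalDegree_wirePoly_le _)

theorem totalDegree_zprod_le (m : ℕ) : (zprod m).totalDegree ≤ TavenasVn.R (4 * m) := by
  unfold zprod
  refine (totalDegree_finsetProd _ _).trans ?_
  calc ∑ l : Fin (TavenasVn.R (4 * m)), (zFactor m l).totalDegree ≤ ∑ _l : Fin (TavenasVn.R (4 * m)), 1 :=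
        Finset.sum_le_sum fun l _ => totalDegree_zFactor_le m l
    _ = TavenasVn.R (4 * m) := by rw [Finset.sum_const, Finset.card_univ, Fintype.card_fin, smul_eq_mul, mul_one]

/-- **Degree of the witness**: `≤ 3·|vCirc (4m)| + 5m + (8m+3)`. -/
theorem totalDegree_witness_le (m : ℕ) :
    (witness m).totalDegree ≤ 3 * (vCirc (4 * m)).size + 5 * m + TavenasVn.R (4 * m) := by
  unfold witness
  refine (totalDegree_mul _ _).trans ?_
  refine Nat.add_le_add ((totalDegree_mul _ _).trans (Nat.add_le_add ?_ (totalDegree_hsel_le m)))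
    (totalDegree_zprod_le m)
  exact (totalDegree_rename_le _ _).trans (totalDegree_validPoly_le' _)

/-! ### The hex digit lift family and its `VNP` membership (Bürgisser Def. 2.5) -/

/-- The hex digit lift of `V_{4m}` (verbatim the polynomial of stubs V2/T2 of line `hex-bilinear-transport`). -/
def hexLift (m : ℕ) : MvPolynomial (V m) ℂ :=
  ∑ i ∈ Finset.range (16 ^ m), C ((2 : ℂ) ^ vExp (4 * m) i) *
    ∏ j : Fin m, X (j, (⟨i / 16 ^ (j : ℕ) % 16, Nat.mod_lt _ (by norm_num)⟩ : Fin 16))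

theorem totalDegree_hexLift_le (m : ℕ) : (hexLift m).totalDegree ≤ m := by
  unfold hexLift
  refine totalDegree_finsetSum_le fun i _ => ?_
  refine (totalDegree_mul _ _).trans ?_
  rw [totalDegree_C, zero_add]
  refine (totalDegree_finsetProd _ _).trans ?_
  calc ∑ j : Fin m, (X (j, (⟨i / 16 ^ (j : ℕ) % 16, Nat.mod_lt _ (by norm_num)⟩ : Fin 16)) :
          MvPolynomial (V m) ℂ).totalDegree ≤ ∑ _j : Fin m, 1 :=
        Finset.sum_le_sum fun j _ => totalDegree_X_le_one' (k := ℂ) _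
    _ = m := by simp

theorem isPFamily_hexLift : @IsPFamily ℂ _ (fun m => V m) _ hexLift := by
  refine ⟨?_, IsPBounded.mono IsPBounded.id fun m => totalDegree_hexLift_le m⟩
  refine IsPBounded.mono (IsPBounded.mul_holds (IsPBounded.const 16) IsPBounded.id) fun m => ?_
  simp [V, mul_comm]

/-- Tavenas' circuit is polynomial-size in the level. -/
theorem isPBounded_vExpSize : IsPBounded fun m : ℕ => TavenasVn.vExpSize (4 * m) := by
  have c := fun k : ℕ => IsPBounded.const k
  have h4 : IsPBounded (fun m : ℕ => 4 * m) := IsPBounded.mul_holds (c 4) IsPBounded.id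
  have hstep : IsPBounded (fun m : ℕ => Literature.Computability.Complexity.ArithCkt.mulStepSize (4 * m)) := by
    unfold Literature.Computability.Complexity.ArithCkt.mulStepSize
      Literature.Computability.Complexity.ArithCkt.addSize
    exact IsPBounded.add_holds (IsPBounded.add_holds h4 h4)
      (IsPBounded.add_holds (IsPBounded.mul_holds (c 73) (IsPBounded.add_holds h4 h4)) (c 1))
  unfold TavenasVn.vExpSize
  exact IsPBounded.add_holds (IsPBounded.add_holds h4
    (IsPBounded.add_holds (IsPBounded.mul_holds h4 hstep) (c 1))) (c 1)

/-- The cost function of the level-wise assembly. -/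
def bound (m : ℕ) : ℕ := 60 * TavenasVn.vExpSize (4 * m) + 300 * (m + 1)

theorem isPBounded_bound : IsPBounded bound := by
  unfold bound
  exact IsPBounded.add_holds (IsPBounded.mul_holds (IsPBounded.const 60) isPBounded_vExpSize)
    (IsPBounded.mul_holds (IsPBounded.const 300) (IsPBounded.add_holds IsPBounded.id (IsPBounded.const 1)))

theorem card_B (m : ℕ) : Fintype.card (B m) = 4 * m + (vCirc (4 * m)).size := by
  simp [B, TavenasVn.BB]

theorem R_eq (m : ℕ) : TavenasVn.R (4 * m) = 8 * m + 3 := by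
  unfold TavenasVn.R; ring

/-- **V′ (PROVED): the hex digit lift of `V_{4m}` is a `VNP` family over `ℂ`** — Bürgisser Def. 2.5 with the
transcript witness: Boolean length `4m + |vCirc (4m)|`, complexity `≤ 60|vCirc| + 249 m + 11`, degree
`≤ 3|vCirc| + 13 m + 3`, all `≤ bound m = 60·vExpSize (4m) + 300 (m+1)`, p-bounded. -/
theorem isVNPFamily_hexLift : @IsVNPFamily ℂ _ (fun m => V m) _ hexLift := by
  refine isVNPFamily_of_levelwise' isPFamily_hexLift isPBounded_bound fun m => ?_
  have hs : (vCirc (4 * m)).size ≤ TavenasVn.vExpSize (4 * m) := size_vCirc_le (4 * m)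
  refine ⟨Fintype.card (B m), rename (Sum.map id (Fintype.equivFin (B m))) (witness m),
    boolSum_witness m, ?_, ?_, ?_⟩
  · rw [card_B]; unfold bound; omega
  · refine ((complexity_rename_le_holds' _ _).trans (complexity_witness_le m)).trans ?_
    rw [R_eq]; unfold bound; omega
  · refine ((totalDegree_rename_le _ _).trans (totalDegree_witness_le m)).trans ?_
    rw [R_eq]; unfold bound; omega

/-- **V′ in the verbatim form of the registered stub** `stub_vnpHexLift`'s CONCLUSION (no V1 hypothesis). -/
theorem vnpHexLift :
    @IsVNPFamily ℂ _ (fun m => Fin m × Fin 16) _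
      (fun m => ∑ i ∈ Finset.range (16 ^ m), C ((2 : ℂ) ^ vExp (4 * m) i) *
        ∏ j : Fin m, X (j, (⟨i / 16 ^ (j : ℕ) % 16, Nat.mod_lt _ (by norm_num)⟩ : Fin 16))) :=
  isVNPFamily_hexLift

/-! ### Bonus: stub V1 of the registered line (`stub_hexBilinearExponent`) PROVED, so that with
`stub_vnpHexLift := fun _ => vnpHexLift` the whole V-half of `hex-bilinear-transport` is closed verbatim
(no restatement of `collapse_of` / `HutchinsonMagnification_of` needed). -/

/-- `2^{4m} − 1 = Σ_{l<m} 15·16^l` (all ones in base 16). -/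
theorem two_pow_four_mul_sub_one (m : ℕ) : 2 ^ (4 * m) - 1 = ∑ l : Fin m, 15 * 16 ^ (l : ℕ) := by
  rw [Fin.sum_univ_eq_sum_range (fun l => 15 * 16 ^ l) m, ← Finset.mul_sum,
    Nat.geomSum_eq (by norm_num) m, pow_mul]
  norm_num
  have h : 15 ∣ 16 ^ m - 1 := by
    simpa using Nat.sub_one_dvd_pow_sub_one 16 m
  omega

/-- **V1 = `stub_hexBilinearExponent` (PROVED):** the Kurtz exponent is bilinear in the hex digits. -/
theorem hexBilinearExponent (m : ℕ) (d : Fin m → Fin 16) :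
    vExp (4 * m) (∑ j : Fin m, (d j : ℕ) * 16 ^ (j : ℕ)) =
      2 * ∑ j : Fin m, ∑ l : Fin m, ((d j : ℕ) * (15 - (d l : ℕ))) * 16 ^ ((j : ℕ) + (l : ℕ)) := by
  unfold vExp
  congr 1
  have hsub : 2 ^ (4 * m) - 1 - ∑ j : Fin m, (d j : ℕ) * 16 ^ (j : ℕ) =
      ∑ l : Fin m, (15 - (d l : ℕ)) * 16 ^ (l : ℕ) := by
    rw [two_pow_four_mul_sub_one, ← Finset.sum_tsub_distrib]
    · refine Finset.sum_congr rfl fun l _ => ?_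
      rw [Nat.sub_mul]
    · intro l _
      exact Nat.mul_le_mul_right _ (by have := (d l).isLt; omega)
  rw [hsub, Finset.sum_mul_sum]
  refine Finset.sum_congr rfl fun j _ => Finset.sum_congr rfl fun l _ => ?_
  rw [pow_add]; ring

/-! ### Bonus 2: stub T2 of the registered line (`stub_kroneckerHex`) from the landed GENERIC digit-lift lemmas -/

/-- **T2 = `stub_kroneckerHex` (PROVED):** the hex lift is set-multilinear over the `m` blocks, has total degree
exactly `m`, and the inverse Kronecker substitution `y_{(j,h)} ↦ X^{h·16^j}` maps it to `V_{4m}` over `ℂ`. -/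
theorem kroneckerHex (m : ℕ) :
    IsSetMultilinear (Prod.fst : Fin m × Fin 16 → Fin m) Finset.univ
      (∑ i ∈ Finset.range (16 ^ m), C ((2 : ℂ) ^ vExp (4 * m) i) *
        ∏ j : Fin m, X (j, (⟨i / 16 ^ (j : ℕ) % 16, Nat.mod_lt _ (by norm_num)⟩ : Fin 16)) :
          MvPolynomial (Fin m × Fin 16) ℂ) ∧
    (∑ i ∈ Finset.range (16 ^ m), C ((2 : ℂ) ^ vExp (4 * m) i) *
        ∏ j : Fin m, X (j, (⟨i / 16 ^ (j : ℕ) % 16, Nat.mod_lt _ (by norm_num)⟩ : Fin 16)) :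
          MvPolynomial (Fin m × Fin 16) ℂ).totalDegree = m ∧
    MvPolynomial.aeval (fun v : Fin m × Fin 16 => (Polynomial.X : Polynomial ℂ) ^ ((v.2 : ℕ) * 16 ^ (v.1 : ℕ)))
        (∑ i ∈ Finset.range (16 ^ m), C ((2 : ℂ) ^ vExp (4 * m) i) *
          ∏ j : Fin m, X (j, (⟨i / 16 ^ (j : ℕ) % 16, Nat.mod_lt _ (by norm_num)⟩ : Fin 16)) :
            MvPolynomial (Fin m × Fin 16) ℂ) =
      (tavenasV (4 * m)).map (Int.castRingHom ℂ) := by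
  have hdig : ∀ i ∈ Finset.range (16 ^ m),
      ∑ j : Fin m, (((⟨i / 16 ^ (j : ℕ) % 16, Nat.mod_lt _ (by norm_num)⟩ : Fin 16) : ℕ)) * 16 ^ (j : ℕ) = i :=
    fun i hi => dk_sum_digit_mul_pow 16 (by norm_num) m i (Finset.mem_range.1 hi)
  refine ⟨dk_isSetMultilinear_lift m 16 _ (fun i => (2 : ℂ) ^ vExp (4 * m) i) _, ?_, ?_⟩
  · refine dk_totalDegree_lift m 16 _ (fun i => (2 : ℂ) ^ vExp (4 * m) i)
      (fun i j => (⟨i / 16 ^ (j : ℕ) % 16, Nat.mod_lt _ (by norm_num)⟩ : Fin 16)) 0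
      (Finset.mem_range.2 (by positivity)) (fun i hi hd0 => ?_) (pow_ne_zero _ two_ne_zero)
    have h := hdig i hi
    have h0 : ∀ j : Fin m, i / 16 ^ (j : ℕ) % 16 = 0 := fun j => by
      have := congrArg (fun f => ((f j : Fin 16) : ℕ)) hd0
      simpa using this
    rw [← h]
    exact Finset.sum_eq_zero fun j _ => by simp [h0 j]
  · rw [dk_aeval_lift m 16 _ (fun i => (2 : ℂ) ^ vExp (4 * m) i) _ hdig, map_tavenasV' ℂ (4 * m)]
    have h16 : (16 : ℕ) ^ m = 2 ^ (4 * m) := by rw [pow_mul]; norm_num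
    rw [h16]

/-! ### The three stubs of `hex-bilinear-transport`'s V-half (+ T2), in VERBATIM registered form -/

/-- Registered stub V1, verbatim. -/
theorem stub_hexBilinearExponent_closed :
    ∀ (m : ℕ) (d : Fin m → Fin 16),
      vExp (4 * m) (∑ j : Fin m, (d j : ℕ) * 16 ^ (j : ℕ)) =
        2 * ∑ j : Fin m, ∑ l : Fin m, ((d j : ℕ) * (15 - (d l : ℕ))) * 16 ^ ((j : ℕ) + (l : ℕ)) :=
  hexBilinearExponent

/-- Registered stub V2, verbatim (its V1 hypothesis is not even used). -/
theorem stub_vnpHexLift_closed :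
    (∀ (m : ℕ) (d : Fin m → Fin 16),
      vExp (4 * m) (∑ j : Fin m, (d j : ℕ) * 16 ^ (j : ℕ)) =
        2 * ∑ j : Fin m, ∑ l : Fin m, ((d j : ℕ) * (15 - (d l : ℕ))) * 16 ^ ((j : ℕ) + (l : ℕ))) →
    @IsVNPFamily ℂ _ (fun m => Fin m × Fin 16) _
      (fun m => ∑ i ∈ Finset.range (16 ^ m), C ((2 : ℂ) ^ vExp (4 * m) i) *
        ∏ j : Fin m, X (j, (⟨i / 16 ^ (j : ℕ) % 16, Nat.mod_lt _ (by norm_num)⟩ : Fin 16))) :=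
  fun _ => vnpHexLift

/-- Registered stub T2, verbatim. -/
theorem stub_kroneckerHex_closed :
    ∀ m : ℕ,
      IsSetMultilinear (Prod.fst : Fin m × Fin 16 → Fin m) Finset.univ
        (∑ i ∈ Finset.range (16 ^ m), C ((2 : ℂ) ^ vExp (4 * m) i) *
          ∏ j : Fin m, X (j, (⟨i / 16 ^ (j : ℕ) % 16, Nat.mod_lt _ (by norm_num)⟩ : Fin 16)) :
            MvPolynomial (Fin m × Fin 16) ℂ) ∧
      (∑ i ∈ Finset.range (16 ^ m), C ((2 : ℂ) ^ vExp (4 * m) i) *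
          ∏ j : Fin m, X (j, (⟨i / 16 ^ (j : ℕ) % 16, Nat.mod_lt _ (by norm_num)⟩ : Fin 16)) :
            MvPolynomial (Fin m × Fin 16) ℂ).totalDegree = m ∧
      MvPolynomial.aeval (fun v : Fin m × Fin 16 => (Polynomial.X : Polynomial ℂ) ^ ((v.2 : ℕ) * 16 ^ (v.1 : ℕ)))
          (∑ i ∈ Finset.range (16 ^ m), C ((2 : ℂ) ^ vExp (4 * m) i) *
            ∏ j : Fin m, X (j, (⟨i / 16 ^ (j : ℕ) % 16, Nat.mod_lt _ (by norm_num)⟩ : Fin 16)) :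
              MvPolynomial (Fin m × Fin 16) ℂ) =
        (tavenasV (4 * m)).map (Int.castRingHom ℂ) :=
  kroneckerHex

end Summit.ValiantsHypothesis.ValiantsHypothesis.Cruxes.HutchinsonMagnification.DefinabilityProjection

end
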